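import Summits.QuantumFields.YangMills.Theorems.UnitScaleTiltProp7PoissonGradientDecayAllMembers
import HarnessLib

/-!
# Route `UnitScaleTilt`, crux K1 «MinimiserStabilityRegPr» (stmt-QuantumFields-19200), EX face — **(R3) T1-CORE AT EVERY MEMBER**: px19 g13's T1-core
# ✓`Prop7MassiveSolutionGradientSup.norm_equiv_DL2_le_of_sup` (the UNWEIGHTED gradient sup row of a covariant Poisson-type equation `Δ^η_{U₀}u + q = 0` from the global sups of
# `u`, `q`) with its no-wrap antecedent `hroom : 2(12·L^{K−n} + 5) ≤ sitesPerDir 0` DELETED, SAME constant — the `κ = 0` reading of (R1) ✓`gradient_decay_of_decay_allMembers`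
# (the T1 row read on the `L³`-fold cover).  This is the SECOND root through which the room enters the 19200 cone: the one-form storey (px5 g13 ✓`Prop7OneFormGradientSup`,
# ✓`…GradientSupNabla`, px17 ✓`Prop7GaugeModeHessianRow`∕(H∇) ✓`Prop7ChainPotentialHessianRow`, px21 (∇0) ✓`Prop7OneFormGreenBlockGradient{,KFree,Family}`) displays `hroom` only because
# it calls this row; their roomless editions are one-token re-runs over §1.  (Width seat `ym3-torus-px5` gen 15.)

Cell `ym3-torus` (HUMAN RULING D-0037; rung R3 = SU(2) YM₃ on T³ — NOT d = 4, NOT infinite volume, NOT a mass gap, NOT Clay).  THEOREMS ONLY (0 `def`, 0 `sorry`, default heartbeats);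
`--supports stmt-QuantumFields-19200 --as helper`; count-neutral.

WHAT IS PROVED (ns `Summit.QuantumFields.YangMills.Theorems.Prop7MassiveSolutionGradientSupAllMembers`; member `F`, ANY `n K`).
* §1 ★★★ **`norm_equiv_DL2_le_of_sup_allMembers`** — ✓`norm_equiv_DL2_le_of_sup` VERBATIM WITHOUT `hroom`: for `u q` with `Δ^η_{U₀}u + q = D*_{U₀}0`, `‖u(x)‖ ≤ M_u`, `‖q(x)‖ ≤ M_q`
  everywhere, `RegPr`, `0 < ε₀ ≤ 1` and the margin `C_g·(48ε₀(6√2√10 + 6√2)) ≤ ½`: at every bond `p`,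
  `‖(D_{U₀}u)(p)‖ ≤ 2·(C_g·(M_u·(2 + 2√2·4ε₀(3 + 2457C) + (24√10 + 48)(48ε₀)²) + M_q) + 2√2·48ε₀·M_u)` — (R1) at `κ := 0`, `y := B(0)`, `A_u := M_u`, `A_q := M_q`
  (`e^{51·0} = e^{−0·d} = 1`), read at `p = e b` (✓`bondEquiv` onto).
* §2 ★★ `norm_toL2_symm_DL2_le_of_sup_allMembers` — the route-matrix reading `‖toL2⁻¹(D_{U₀}u) b‖ ≤ …` (✓`norm_frobEquiv_le`), the shape px17 ✓`Prop7GaugeModeHessianRow` :136 consumes.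
HYP-SAT (★★OWNER RULING №42).  Exactly T1-core's hypotheses minus the room (`RegPr` = the EX face's class; the equation; two global sup letters; `hsmall` = print's smallness of `ε₀` vs the
universal `C_g`, K-free); conclusions explicit sup rows; no `Prop` placeholder.
HONEST SCOPE.  A specialisation of (R1); nothing of the one-form storey's editions, `norm_G`, the EX rows, EX, 19200 or the rung is proved here; the Yang–Mills mass gap is NOT proved.

References: T. Bałaban, CMP **99** (1985) 389–434 [Balaban1985BackgroundPropagators] (Thm 3.1 (3.42)–(3.47) pp.397–399, p.399 L1–3, (3.11) p.392); CMP **96** (1984) 223–250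
[Balaban1984PropagatorsII] (Lemma 2.1 (2.61)–(2.63) p.234).
-/

set_option autoImplicit false

noncomputable section

open scoped BigOperators Matrix.Norms.L2Operator InnerProductSpace ComplexConjugate

namespace Summit.QuantumFields.YangMills.Theorems.Prop7MassiveSolutionGradientSupAllMembers

open Literature.MathematicalPhysics.QuantumFieldTheory.Balaban1983to89
open Literature.MathematicalPhysics.QuantumFieldTheory.Balaban1983to89.T3ContinuumYM3Torus
open B4Sect5Torus (TSite)
open B9SectCLatticeCarrier (Bond)
open B9Eq311L2Pairing (WL2)
open B11Eq103H1Complex (SiteL2K BondL2K)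
open B5Eq118OneStroke (iterBlockOf)
open T3PrintedRegularMinimiser (RegPr)
open Summit.QuantumFields.YangMills.Theorems.Prop7SectET3Transport (periodsT3 siteEquiv bondEquiv)
open Summit.QuantumFields.YangMills.Theorems.Prop7SectET3HilbertLetters (W₂ frobEquiv toL2 DL2 DstarL2 covLapSite toL2_symm_apply)
open Summit.QuantumFields.YangMills.Theorems.Prop7RieszTauFrobNorm (norm_frobEquiv_le)
open Summit.QuantumFields.YangMills.Theorems.Prop7CurvedMemberLocalGradient (exists_curved_localGradient)
open Summit.QuantumFields.YangMills.Theorems.AxialGaugeChartGlue (norm_bgOfCfg_axialT_sub_le)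
open Summit.QuantumFields.YangMills.Theorems.Prop7PoissonGradientDecayAllMembers (gradient_decay_of_decay_allMembers)

variable (F : T3Family) (n K : ℕ) {ε₀ : ℝ} (hε₀ : 0 < ε₀) (hε1 : ε₀ ≤ 1)
  (U₀ : GaugeField (F.P K) 0 (Matrix.specialUnitaryGroup (Fin 2) ℂ)) (hreg : RegPr F n K ε₀ U₀)
  (c₀ : ℝ) [Fact (0 < c₀)]

/-! ## §1 ★★★ T1-core at every member -/

include hε₀ hε1 hreg in
/-- ★★★ **T1-CORE AT EVERY MEMBER, NO ROOM** ([Balaban1985BackgroundPropagators] Thm 3.1 (3.42)–(3.44) at a regular curved background; px19 ✓`norm_equiv_DL2_le_of_sup` with `hroom`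
deleted, SAME constant).  For `u q` with `Δ^η_{U₀}u + q = D*_{U₀}0`, global sups `‖u(x)‖ ≤ M_u`, `‖q(x)‖ ≤ M_q` and the margin `C_g·(48ε₀(6√2√10 + 6√2)) ≤ ½`: at every bond `p`,
`‖(D_{U₀}u)(p)‖ ≤ 2·(C_g·(M_u·(2 + 2√2·4ε₀(3 + 2457C) + (24√10 + 48)(48ε₀)²) + M_q) + 2√2·48ε₀·M_u)` — (R1) ✓`gradient_decay_of_decay_allMembers` at rate `κ = 0`.
[cite: Balaban1985BackgroundPropagators, Thm 3.1 (3.42)–(3.44) pp.397–398, p.399 L1–3; Balaban1984PropagatorsII, Lemma 2.1 (2.61)–(2.63) p.234] -/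
theorem norm_equiv_DL2_le_of_sup_allMembers (u q : SiteL2K ℂ 3 (periodsT3 F K) c₀ W₂)
    (h : covLapSite F n K c₀ U₀ u + q = DstarL2 F n K c₀ U₀ 0) {Mu Mq : ℝ} (hMu0 : 0 ≤ Mu) (hMq0 : 0 ≤ Mq)
    (hMu : ∀ x : TSite 3 (periodsT3 F K), ‖WL2.equiv ℂ (fun _ : TSite 3 (periodsT3 F K) => c₀) W₂ u x‖ ≤ Mu)
    (hMq : ∀ x : TSite 3 (periodsT3 F K), ‖WL2.equiv ℂ (fun _ : TSite 3 (periodsT3 F K) => c₀) W₂ q x‖ ≤ Mq)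
    (hsmall : exists_curved_localGradient.choose * ((48 * ε₀) * (6 * Real.sqrt 2 * Real.sqrt 10 + 6 * Real.sqrt 2)) ≤ 1 / 2) :
    ∀ p : Bond 3 (periodsT3 F K), ‖WL2.equiv ℂ (fun _ : Bond 3 (periodsT3 F K) => c₀) W₂ (DL2 F n K c₀ U₀ u) p‖
      ≤ 2 * (exists_curved_localGradient.choose *
            (Mu * (2 + 2 * Real.sqrt 2 * (4 * ε₀ * (3 + 2457 * norm_bgOfCfg_axialT_sub_le.choose)) + (24 * Real.sqrt 10 + 48) * (48 * ε₀) ^ 2) + Mq)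
          + 2 * Real.sqrt 2 * (48 * ε₀) * Mu) := by
  intro p
  obtain ⟨b, rfl⟩ := (bondEquiv F K).surjective p
  -- (R1) at `κ = 0`, about the block of the origin
  set y : Site (F.P K) (K - n) := iterBlockOf (K - n) (fun _ => 0) with hy
  have hu : ∀ x : Site (F.P K) 0, ‖WL2.equiv ℂ (fun _ : TSite 3 (periodsT3 F K) => c₀) W₂ u (siteEquiv F K x)‖
      ≤ Mu * Real.exp (-((0 : ℝ) * (Site.tdist (P := F.P K) (iterBlockOf (K - n) x) y : ℝ))) := fun x => by
    rw [zero_mul, neg_zero, Real.exp_zero, mul_one]; exact hMu _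
  have hq : ∀ x : Site (F.P K) 0, ‖WL2.equiv ℂ (fun _ : TSite 3 (periodsT3 F K) => c₀) W₂ q (siteEquiv F K x)‖
      ≤ Mq * Real.exp (-((0 : ℝ) * (Site.tdist (P := F.P K) (iterBlockOf (K - n) x) y : ℝ))) := fun x => by
    rw [zero_mul, neg_zero, Real.exp_zero, mul_one]; exact hMq _
  have hsmall' : exists_curved_localGradient.choose * ((48 * ε₀) * (6 * Real.sqrt 2 * Real.sqrt 10 + 6 * Real.sqrt 2)) * Real.exp (51 * (0 : ℝ)) ≤ 1 / 2 := by
    rw [mul_zero, Real.exp_zero, mul_one]; exact hsmall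
  have h1 := gradient_decay_of_decay_allMembers F n K hε₀ hε1 U₀ hreg c₀ u q h y le_rfl hMu0 hMq0 hu hq hsmall' b
  rw [mul_zero, zero_mul, neg_zero, Real.exp_zero, mul_one, mul_one, mul_one] at h1
  exact h1

include hε₀ hε1 hreg in
/-- ★★ **T1-CORE AT EVERY MEMBER, ROUTE-MATRIX READING**: the same bound for `‖toL2⁻¹(D_{U₀}u) b‖` at every route bond (operator norm ≤ Frobenius norm = the `W₂` reading at `e b`,
✓`norm_frobEquiv_le`) — the shape consumed at px17 ✓`Prop7GaugeModeHessianRow` :136, without `hroom`. [cite: Balaban1985BackgroundPropagators, Thm 3.1 (3.42)–(3.44) pp.397–398, (3.11) p.392] -/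
theorem norm_toL2_symm_DL2_le_of_sup_allMembers (u q : SiteL2K ℂ 3 (periodsT3 F K) c₀ W₂)
    (h : covLapSite F n K c₀ U₀ u + q = DstarL2 F n K c₀ U₀ 0) {Mu Mq : ℝ} (hMu0 : 0 ≤ Mu) (hMq0 : 0 ≤ Mq)
    (hMu : ∀ x : TSite 3 (periodsT3 F K), ‖WL2.equiv ℂ (fun _ : TSite 3 (periodsT3 F K) => c₀) W₂ u x‖ ≤ Mu)
    (hMq : ∀ x : TSite 3 (periodsT3 F K), ‖WL2.equiv ℂ (fun _ : TSite 3 (periodsT3 F K) => c₀) W₂ q x‖ ≤ Mq)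
    (hsmall : exists_curved_localGradient.choose * ((48 * ε₀) * (6 * Real.sqrt 2 * Real.sqrt 10 + 6 * Real.sqrt 2)) ≤ 1 / 2)
    (b : PBond (F.P K) 0) :
    ‖(toL2 F K c₀).symm (DL2 F n K c₀ U₀ u) b‖
      ≤ 2 * (exists_curved_localGradient.choose *
            (Mu * (2 + 2 * Real.sqrt 2 * (4 * ε₀ * (3 + 2457 * norm_bgOfCfg_axialT_sub_le.choose)) + (24 * Real.sqrt 10 + 48) * (48 * ε₀) ^ 2) + Mq)
          + 2 * Real.sqrt 2 * (48 * ε₀) * Mu) := by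
  rw [toL2_symm_apply]
  exact (norm_frobEquiv_le _).trans (norm_equiv_DL2_le_of_sup_allMembers F n K hε₀ hε1 U₀ hreg c₀ u q h hMu0 hMq0 hMu hMq hsmall (bondEquiv F K b))

end Summit.QuantumFields.YangMills.Theorems.Prop7MassiveSolutionGradientSupAllMembers

end
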